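import Summits.NavierStokesRegularity.FunctionalMining.StretchingHolderBound
import Literature.Analysis.FluidPDE.MillerStrainDeterminantBound
import Literature.Analysis.FunctionSpaces.TorusPlanarLift
import HarnessLib

/-!
# K1-Q1 sub-classes, UPPER side: `σ ≤ ½·M·ℰ` on 2½-dimensional fields and `σ ≤ (2√6/9)·Σ·ℰ` under a strain sup

NS FUNCTIONAL MINING cell (`pub-nsfunc`), dictionary seat — **search for candidate a priori
estimates; no regularity claim.** Nothing in this file is a statement about Navier–Stokes
solutions or their regularity; these are STATIC field inequalities on the unit 3-torus.

K0 row K1-Q1 asks for the best constant `C⋆ = stretchingSupConst` in the static sup-stretching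
inequality `σ(v) = ∫⟪(v·∇)v, Δv⟫ ≤ C·M·ℰ(v)` (`StretchingSupBound C`; `ℰ = ½‖∇v‖₂²`,
`|ω|² ≤ M²` pointwise). The tree knows `√6/24 ≤ C⋆ ≤ 2/√3` (`ThreeWaveStretchingLower`,
`stretchingSupHolder_holds`) and the bank family rungs (`StretchingLowerFamily`). This file types
the UPPER bounds of two natural SUB-CLASSES singled out by the bank seat's hand analysis
(`pub-nsfunc-bank/K1Q1-PRESSURELESS.md` §4, `K1Q1-HALF.md` §1):

* **2½-dimensional fields** (`∂ₖv ≡ 0` for some coordinate `k`, e.g. every `Torus.twoHalf V R`):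
  `σ ≤ ½·M·ℰ` (`enstrophyProduction_le_half_of_partialDeriv_eq_zero`,
  `stretchingSupBoundPlanar_half`). Mechanism, entirely pointwise: if the column `∂ₖv` of the
  gradient vanishes then `ωᵀSω = ω_hᵀS_hω_h` (the `S₁₃, S₂₃` entries pair `ω_h` with `ω₃` and
  cancel), `ω_hᵀS_hω_h ≤ s|ω_h|²` with `s² = ½|S_h|²`, `|ω_h| ≤ M`, and AM–GM
  `s·M·|ω_h| ≤ M(s² + ¼|ω_h|²) = (M/2)|S|²` — EXACTLY half the full strain norm, because
  `|S|² = 2s² + ½|ω_h|²` for such gradients; integrate with `∫|S|² = ℰ`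
  (`integral_strainNormSq_eq_torusEnstrophy`) and Betchov/orthogonality `σ = ∫ωᵀSω`.
  The bank's cellular-strain + confined-wave family shows `½` is the EXACT constant of this class
  (hand proof, `K1Q1-HALF.md` Thm 1; NOT formalised here), whence `½ ≤ C⋆` at paper level.
* **strain-sup class**: if `|S(x)|_F ≤ Σ` pointwise then `σ = −4∫det S ≤ (2√6/9)∫|S|³ ≤ (2√6/9)·Σ·ℰ`
  (`enstrophyProduction_le_strainSup`, from the tree's Miller bound
  `neg_integral_stretching_le_strain_cube`); in particular for PRESSURELESS fields
  (`|S|² = ½|ω|²` pointwise, i.e. `Δp = ½|ω|² − |S|² = 0`) with `|ω| ≤ M` one may take `Σ = M/√2`: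
  `σ ≤ (2√3/9)·M·ℰ` (`enstrophyProduction_le_of_strainSq_le_half_sq`). The bank's composition
  family `u = (0, −c g(x₁), T(x₂ + g(x₁)))` shows `2√3/9` is the exact constant of the pressureless
  class (`K1Q1-PRESSURELESS.md` §2/§4a; kernel version with the prove seat), whence `2√3/9 ≤ C⋆`.

So, at kernel level after this file: `C_{2.5D} ≤ ½` and `C_{|S|≤M/√2} ≤ 2√3/9 < ½ < 2/√3`; whether
genuinely three-dimensional fields beat `½` is the open part of K1-Q1. One definition
(`StretchingSupBoundPlanar`, the row restricted to 2½-D fields); everything else is a theorem.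
Search for candidate a priori estimates; no regularity claim.
-/

noncomputable section

open Set MeasureTheory Finset
open scoped InnerProductSpace RealInnerProductSpace

namespace Summit.NavierStokesRegularity.FunctionalMining

open Literature.Analysis.FunctionSpaces Literature.Analysis.FluidPDE

/-! ## Pointwise algebra: the planar (zero-column) stretching bound -/

namespace PlanarStretching

/-- **Scalar core.** For reals with `a² + b² + c² ≤ M²`, `M ≥ 0`:
`p(a² − b²) − 2qab ≤ (M/2)(2p² + 2q² + ½(a² + b²))` — Cauchy–Schwarz
`(p(a²−b²) − 2qab)² ≤ (p²+q²)(a²+b²)²` (exact SOS complement `(q(a²−b²) + 2pab)²`), `a² + b² ≤ M²`,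
and AM–GM. [ours; elementary] -/
theorem quadForm_le_half {p q a b c M : ℝ} (hM : 0 ≤ M) (hw : a ^ 2 + b ^ 2 + c ^ 2 ≤ M ^ 2) :
    p * (a ^ 2 - b ^ 2) - 2 * q * a * b ≤ M / 2 * (2 * p ^ 2 + 2 * q ^ 2 + (a ^ 2 + b ^ 2) / 2) := by
  set Q : ℝ := p * (a ^ 2 - b ^ 2) - 2 * q * a * b with hQ
  set σ : ℝ := p ^ 2 + q ^ 2 with hσ
  set ρ : ℝ := a ^ 2 + b ^ 2 with hρ
  have hσ0 : 0 ≤ σ := by positivity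
  have hρ0 : 0 ≤ ρ := by positivity
  have hρM : ρ ≤ M ^ 2 := by nlinarith [sq_nonneg c]
  have hQ2 : Q ^ 2 ≤ σ * ρ ^ 2 := by
    have hid : σ * ρ ^ 2 - Q ^ 2 = (q * (a ^ 2 - b ^ 2) + 2 * p * a * b) ^ 2 := by
      simp only [hQ, hσ, hρ]; ring
    nlinarith [sq_nonneg (q * (a ^ 2 - b ^ 2) + 2 * p * a * b)]
  have hR : M / 2 * (2 * p ^ 2 + 2 * q ^ 2 + (a ^ 2 + b ^ 2) / 2) = M * (σ + ρ / 4) := by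
    simp only [hσ, hρ]; ring
  have hR0 : 0 ≤ M * (σ + ρ / 4) := by positivity
  have hR2 : σ * ρ ^ 2 ≤ (M * (σ + ρ / 4)) ^ 2 := by
    have hid : (M * (σ + ρ / 4)) ^ 2 - σ * ρ ^ 2 =
        M ^ 2 * (σ - ρ / 4) ^ 2 + σ * ρ * (M ^ 2 - ρ) := by ring
    nlinarith [sq_nonneg (M * (σ - ρ / 4)), mul_nonneg (mul_nonneg hσ0 hρ0) (sub_nonneg.2 hρM)]
  rw [hR]
  exact (abs_le_of_sq_le_sq' (hQ2.trans hR2) hR0).2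

/-- **The pointwise planar stretching bound.** For a trace-free `3 × 3` array `G` (`Gᵢⱼ = ∂ⱼuᵢ`)
whose LAST COLUMN vanishes (`∂₂u = 0`), its vorticity vector `ω` with `|ω|² ≤ M²` (`M ≥ 0`) and
symmetric part `S`: `tr G³ − tr GGᵀG (= ωᵀSω) ≤ (M/2)·|S|_F²`. [ours; elementary] -/
theorem cubeTrace_sub_stretchCubic_le_half (G : Fin 3 → Fin 3 → ℝ) {M : ℝ} (hM : 0 ≤ M)
    (htr : ∑ i, G i i = 0) (hcol : ∀ i, G i 2 = 0) (w : Fin 3 → ℝ)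
    (hw : w = ![G 2 1 - G 1 2, G 0 2 - G 2 0, G 1 0 - G 0 1]) (hω : ∑ i, w i ^ 2 ≤ M ^ 2) :
    (∑ i, ∑ j, ∑ k, G i j * G j k * G k i) - (∑ i, ∑ j, ∑ m, G i m * G j m * G j i) ≤
      M / 2 * ∑ i, ∑ j, ((G i j + G j i) / 2) ^ 2 := by
  rw [DoeringGibbon1995.cubeTrace_sub_stretchCubic G w hw, htr, mul_zero, sub_zero]
  have h02 : G 0 2 = 0 := hcol 0
  have h12 : G 1 2 = 0 := hcol 1
  have h22 : G 2 2 = 0 := hcol 2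
  have h11 : G 1 1 = -G 0 0 := by
    have h := htr
    simp only [Fin.sum_univ_three, h22, add_zero] at h
    linarith
  have hω' : G 2 1 ^ 2 + G 2 0 ^ 2 + (G 1 0 - G 0 1) ^ 2 ≤ M ^ 2 := by
    have h := hω
    subst hw
    simp only [Fin.sum_univ_three, Matrix.cons_val_zero, Matrix.cons_val_one, Matrix.head_cons,
      Matrix.cons_val_two, Matrix.tail_cons, h02, h12] at h
    nlinarith [h]
  have key := quadForm_le_half (p := G 0 0) (q := (G 0 1 + G 1 0) / 2) (a := G 2 1) (b := G 2 0)
    (c := G 1 0 - G 0 1) hM hω'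
  subst hw
  simp only [Fin.sum_univ_three, Matrix.cons_val_zero, Matrix.cons_val_one, Matrix.head_cons,
    Matrix.cons_val_two, Matrix.tail_cons, h02, h12, h22, h11]
  nlinarith [key]

end PlanarStretching

/-! ## On the torus: 2½-dimensional fields -/

variable {d : Type*} [Fintype d] [DecidableEq d]

/-- **Pointwise, on the torus**: for a smooth divergence-free `v` on `T³`, at a point `x` where
the directional derivative `∂ₖv(x)` vanishes and `|ω(x)|² ≤ M²`, the Betchov-corrected stretching
density is at most `(M/2)·|S(x)|_F²` (coordinates as in `sum_partialDeriv_cube_sub_stretch_le_holder`).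
[ours; elementary] -/
theorem sum_partialDeriv_cube_sub_stretch_le_half (hd : Fintype.card d = 3)
    {v : UnitAddTorus d → EuclideanSpace ℝ d} (hv : Torus.IsSmooth v) (hdiv : Torus.IsDivFree v)
    {k : d} {x : UnitAddTorus d} (hk : Torus.partialDeriv k v x = 0)
    {M : ℝ} (hM : 0 ≤ M) (hω : torusVorticitySqAt v x ≤ M ^ 2) :
    (∑ i, ∑ j, ∑ k, Torus.partialDeriv j v x i * Torus.partialDeriv k v x j *
        Torus.partialDeriv i v x k) -
      (∑ m, ∑ i, Torus.partialDeriv m v x i *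
        ⟪Torus.partialDeriv m v x, Torus.partialDeriv i v x⟫_ℝ) ≤
      M / 2 * ∑ i, ∑ j, ((Torus.partialDeriv j v x i + Torus.partialDeriv i v x j) / 2) ^ 2 := by
  -- coordinates with `k ↦ 2`
  set e₀ : d ≃ Fin 3 := Fintype.equivFinOfCardEq hd with he₀
  set e : d ≃ Fin 3 := e₀.trans (Equiv.swap (e₀ k) 2) with he
  have hek : e k = 2 := by simp [he, Equiv.swap_apply_left]
  have hek' : e.symm 2 = k := by rw [← hek, Equiv.symm_apply_apply]
  set R : d → EuclideanSpace ℝ d := fun m => Torus.partialDeriv m v x with hR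
  set G : Fin 3 → Fin 3 → ℝ := fun a b => R (e.symm b) (e.symm a) with hG
  have hre : ∀ F : d → ℝ, ∑ i, F i = ∑ a : Fin 3, F (e.symm a) := fun F =>
    Fintype.sum_equiv e _ _ fun i => by simp
  -- (i) the cubic trace
  have hB : ∑ i, ∑ j, ∑ k, R j i * R k j * R i k = ∑ a, ∑ b, ∑ c, G a b * G b c * G c a := by
    simp only [hG]
    simp_rw [hre]
  -- (ii) the stretching cubic
  have hC : ∑ m, ∑ i, R m i * ⟪R m, R i⟫_ℝ = ∑ a, ∑ b, ∑ c, G a c * G b c * G b a := by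
    have h1 : ∑ m, ∑ i, R m i * ⟪R m, R i⟫_ℝ = ∑ i, ∑ j, ∑ m, R m i * R m j * R i j := by
      have hinner : ∀ m i, R m i * ⟪R m, R i⟫_ℝ = ∑ j, R m i * R m j * R i j := by
        intro m i
        rw [show ⟪R m, R i⟫_ℝ = ∑ j, R m j * R i j from by simp [PiLp.inner_apply, mul_comm],
          Finset.mul_sum]
        exact Finset.sum_congr rfl fun j _ => by ring
      simp_rw [hinner]
      rw [Finset.sum_comm]
      exact Finset.sum_congr rfl fun i _ => Finset.sum_comm
    rw [h1]
    simp only [hG]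
    simp_rw [hre]
  -- (iii) the trace is the divergence
  have htr : ∑ a, G a a = 0 := by
    have h1 : ∑ a, G a a = ∑ m, R m m := by
      simp only [hG]; rw [hre]
    rw [h1, hR]
    have h2 := Torus.divergence_eq_sum_partialDeriv_apply (hv.isContDiff (by simp)) x
    rw [← h2]
    exact hdiv x
  -- (iv) the last column is `∂ₖv(x) = 0`
  have hcol : ∀ a, G a 2 = 0 := by
    intro a
    simp only [hG, hR, hek', hk, PiLp.zero_apply]
  -- (v) the vorticity
  set w : Fin 3 → ℝ := ![G 2 1 - G 1 2, G 0 2 - G 2 0, G 1 0 - G 0 1] with hw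
  have hvort : ∑ a, w a ^ 2 = torusVorticitySqAt v x := by
    rw [DoeringGibbon1995.sum_vort_sq G w hw, torusVorticitySqAt]
    congr 1
    simp only [hG, hR]
    simp_rw [hre]
    rw [Finset.sum_comm]
  -- (vi) the strain norm
  have hstrain : ∑ a, ∑ b, ((G a b + G b a) / 2) ^ 2 =
      ∑ i, ∑ j, ((R j i + R i j) / 2) ^ 2 := by
    simp only [hG]
    simp_rw [hre]
  have key := PlanarStretching.cubeTrace_sub_stretchCubic_le_half G hM htr hcol w hw (hvort ▸ hω)
  rw [hB, hC, ← hstrain]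
  exact key

/-- **2½-dimensional fields: `σ ≤ ½·M·ℰ`.** For a smooth divergence-free `v` on `T³` with
`∂ₖv ≡ 0` for some coordinate `k` and `|ω(x)|² ≤ M²` pointwise,
`∫⟪(v·∇)v, Δv⟫ ≤ ½ · M · ℰ(v)`. Proof: orthogonality form + Betchov (`σ = ∫ωᵀSω`), the pointwise
planar bound, `‖S‖₂² = ℰ`. The bank's hand analysis (`K1Q1-HALF.md` Thm 1, not formalised) shows
`½` is attained in the limit inside this class. Search for candidate a priori estimates; no
regularity claim. [ours] -/
theorem enstrophyProduction_le_half_of_partialDeriv_eq_zero (hd : Fintype.card d = 3)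
    {v : UnitAddTorus d → EuclideanSpace ℝ d} (hv : Torus.IsSmooth v) (hdiv : Torus.IsDivFree v)
    {k : d} (hk : ∀ x, Torus.partialDeriv k v x = 0)
    {M : ℝ} (hM : 0 ≤ M) (hω : ∀ x, torusVorticitySqAt v x ≤ M ^ 2) :
    enstrophyProduction v ≤ 1 / 2 * M * torusEnstrophy v := by
  have hD : ∀ m, Torus.IsSmooth (Torus.partialDeriv m v) := fun m => hv.partialDeriv m
  have hDc : ∀ m j, Torus.IsSmooth (fun y => Torus.partialDeriv m v y j) :=
    fun m j => (hD m).apply j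
  set B : UnitAddTorus d → ℝ := fun x => ∑ i, ∑ j, ∑ k, Torus.partialDeriv j v x i *
    Torus.partialDeriv k v x j * Torus.partialDeriv i v x k with hB_def
  set C : UnitAddTorus d → ℝ := fun x => ∑ m, ∑ i, Torus.partialDeriv m v x i *
    ⟪Torus.partialDeriv m v x, Torus.partialDeriv i v x⟫_ℝ with hC_def
  set X : UnitAddTorus d → ℝ := fun x =>
    ∑ i, ∑ j, ((Torus.partialDeriv j v x i + Torus.partialDeriv i v x j) / 2) ^ 2 with hX_def
  have hBs : Torus.IsSmooth B := by
    have h : ∀ i j k, Torus.IsSmooth (fun x => Torus.partialDeriv j v x i *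
        Torus.partialDeriv k v x j * Torus.partialDeriv i v x k) :=
      fun i j k => ((hDc j i).mul (hDc k j)).mul (hDc i k)
    unfold Torus.IsSmooth at h ⊢
    exact ContDiff.sum fun i _ => ContDiff.sum fun j _ => ContDiff.sum fun k _ => h i j k
  have hCs : Torus.IsSmooth C := by
    have h : ∀ m i, Torus.IsSmooth (fun x => Torus.partialDeriv m v x i *
        ⟪Torus.partialDeriv m v x, Torus.partialDeriv i v x⟫_ℝ) :=
      fun m i => (hDc m i).mul ((hD m).inner (hD i))
    unfold Torus.IsSmooth at h ⊢
    exact ContDiff.sum fun m _ => ContDiff.sum fun i _ => h m i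
  have hXs : Torus.IsSmooth X := by
    have h : ∀ i j, Torus.IsSmooth (fun x =>
        ((Torus.partialDeriv j v x i + Torus.partialDeriv i v x j) / 2) ^ 2) :=
      fun i j => (((hDc j i).add (hDc i j)).div_const 2).pow 2
    unfold Torus.IsSmooth at h ⊢
    exact ContDiff.sum fun i _ => ContDiff.sum fun j _ => h i j
  -- the production in orthogonality form, Betchov
  have hcomm : enstrophyProduction v = ∫ x, ⟪Torus.laplacian v x, Torus.convect v v x⟫_ℝ := by
    unfold enstrophyProduction
    exact congrArg (fun f : UnitAddTorus d → ℝ => ∫ x, f x)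
      (funext fun x => real_inner_comm (Torus.laplacian v x) (Torus.convect v v x))
  have horth : ∫ x, ⟪Torus.laplacian v x, Torus.convect v v x⟫_ℝ = -∫ x, C x :=
    Torus.integral_inner_laplacian_convect_self_eq_neg hv hdiv
  have hBet : ∫ x, B x = 0 := integral_sum_partialDeriv_cube_eq_zero hv hdiv
  have hdiff : -∫ x, C x = ∫ x, (B x - C x) := by
    rw [integral_sub hBs.integrable hCs.integrable, hBet, zero_sub]
  -- the pointwise planar bound and its integral
  have hpt : ∀ x, B x - C x ≤ M / 2 * X x := fun x =>
    sum_partialDeriv_cube_sub_stretch_le_half hd hv hdiv (hk x) hM (hω x)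
  have hmono : ∫ x, (B x - C x) ≤ ∫ x, M / 2 * X x :=
    integral_mono (hBs.integrable.sub hCs.integrable) (hXs.integrable.const_mul _) hpt
  have hval : ∫ x, M / 2 * X x = 1 / 2 * M * torusEnstrophy v := by
    rw [integral_const_mul, integral_strainNormSq_eq_torusEnstrophy hv hdiv]
    ring
  rw [hcomm, horth, hdiff]
  exact hmono.trans_eq hval

/-- **The K1-Q1 row restricted to 2½-dimensional fields** (bank `K1Q1-HALF.md`): for every smooth
divergence-free `v` on the unit 3-torus which does not depend on one of the coordinates
(`∂ₖv ≡ 0` for some `k`) and every pointwise vorticity majorant `M ≥ 0`,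
`∫⟪(v·∇)v, Δv⟫ ≤ C · M · ℰ(v)`. A FIELD inequality: no time, no solution. The bank's hand result
is `StretchingSupBoundPlanar C ↔ ½ ≤ C` (upper half below; lower half NOT formalised). Search for
candidate a priori estimates; no regularity claim — nothing is asserted. -/
def StretchingSupBoundPlanar (C : ℝ) : Prop :=
  Fintype.card d = 3 → ∀ v : UnitAddTorus d → EuclideanSpace ℝ d,
    Torus.IsSmooth v → Torus.IsDivFree v → (∃ k : d, ∀ x, Torus.partialDeriv k v x = 0) →
      ∀ M : ℝ, 0 ≤ M → (∀ x, torusVorticitySqAt v x ≤ M ^ 2) →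
        enstrophyProduction v ≤ C * M * torusEnstrophy v

/-- The full row implies its 2½-dimensional restriction. [ours; elementary] -/
theorem StretchingSupBound.planar {C : ℝ} (h : StretchingSupBound (d := d) C) :
    StretchingSupBoundPlanar (d := d) C := fun hd v hv hdiv _ M hM hω => h hd v hv hdiv M hM hω

/-- The planar row is monotone in the constant. [ours; elementary] -/
theorem StretchingSupBoundPlanar.mono {C C' : ℝ} (h : StretchingSupBoundPlanar (d := d) C)
    (hC : C ≤ C') : StretchingSupBoundPlanar (d := d) C' := fun hd v hv hdiv hk M hM hω =>
  (h hd v hv hdiv hk M hM hω).trans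
    (mul_le_mul_of_nonneg_right (mul_le_mul_of_nonneg_right hC hM) (torusEnstrophy_nonneg v))

/-- **`C_{2.5D} ≤ ½` in the kernel**: the planar row HOLDS with constant `½` (bank `K1Q1-HALF.md`
§1; the matching lower bound — `½` is not improvable inside the class — is the bank's Thm 1, hand
proof only). Compare `2/√3 ≈ 1.155` for the full row (`stretchingSupHolder_holds`). Search for
candidate a priori estimates; no regularity claim. [ours] -/
theorem stretchingSupBoundPlanar_half : StretchingSupBoundPlanar (d := d) (1 / 2) :=
  fun hd _ hv hdiv ⟨_, hk⟩ _ hM hω =>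
    enstrophyProduction_le_half_of_partialDeriv_eq_zero hd hv hdiv hk hM hω

/-- Every `Torus.twoHalf V R` field (`x ↦ (V(x₀,x₁), R(x₀,x₁))`, the tree's 2½-dimensional lift)
satisfies the hypothesis `∂₂v ≡ 0` of the planar row. [ours; elementary] -/
theorem exists_partialDeriv_eq_zero_twoHalf (V : UnitAddTorus (Fin 2) → EuclideanSpace ℝ (Fin 2))
    (R : UnitAddTorus (Fin 2) → ℝ) :
    ∃ k : Fin 3, ∀ x, Torus.partialDeriv k (Torus.twoHalf V R) x = 0 :=
  ⟨Fin.last 2, fun x => by rw [Torus.partialDeriv_twoHalf_last]; rfl⟩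

/-- **`σ ≤ ½·M·ℰ` for every smooth `twoHalf V R` with `div V = 0`** and `|ω|² ≤ M²` pointwise.
Search for candidate a priori estimates; no regularity claim. [ours] -/
theorem enstrophyProduction_twoHalf_le_half {V : UnitAddTorus (Fin 2) → EuclideanSpace ℝ (Fin 2)}
    {R : UnitAddTorus (Fin 2) → ℝ} (hV : Torus.IsSmooth V) (hR : Torus.IsSmooth R)
    (hdiv : Torus.IsDivFree V) {M : ℝ} (hM : 0 ≤ M)
    (hω : ∀ x, torusVorticitySqAt (Torus.twoHalf V R) x ≤ M ^ 2) :
    enstrophyProduction (Torus.twoHalf V R) ≤ 1 / 2 * M * torusEnstrophy (Torus.twoHalf V R) := by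
  obtain ⟨k, hk⟩ := exists_partialDeriv_eq_zero_twoHalf V R
  exact enstrophyProduction_le_half_of_partialDeriv_eq_zero (Fintype.card_fin 3) (hV.twoHalf hR)
    (hdiv.twoHalf R) hk hM hω

/-! ## On the torus: the strain-sup and pressureless classes -/

/-- **Strain-sup stretching bound: `σ ≤ (2√6/9)·Σ·ℰ`.** For a smooth divergence-free `v` on `T³`
with `|S(x)|_F² ≤ Σ²` pointwise (`Σ ≥ 0`): `∫⟪(v·∇)v, Δv⟫ ≤ (2/9)√6 · Σ · ℰ(v)`, from
`σ = −4∫det S ≤ (2√6/9)∫|S|³` (Miller, tree `neg_integral_stretching_le_strain_cube`), `|S|³ ≤ Σ|S|²`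
and `∫|S|² = ℰ`. The strain-currency analogue of `StretchingSupBound`; sharp constant of the
pointwise step `2√6/9 ≈ 0.544`. Search for candidate a priori estimates; no regularity claim. [ours] -/
theorem enstrophyProduction_le_strainSup (hd : Fintype.card d = 3)
    {v : UnitAddTorus d → EuclideanSpace ℝ d} (hv : Torus.IsSmooth v) (hdiv : Torus.IsDivFree v)
    {N : ℝ} (hN : 0 ≤ N)
    (hS : ∀ x, (∑ i, ∑ j, ((Torus.partialDeriv j v x i + Torus.partialDeriv i v x j) / 2) ^ 2) ≤
      N ^ 2) :
    enstrophyProduction v ≤ 2 / 9 * Real.sqrt 6 * N * torusEnstrophy v := by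
  have hD : ∀ m, Torus.IsSmooth (Torus.partialDeriv m v) := fun m => hv.partialDeriv m
  have hDc : ∀ m j, Torus.IsSmooth (fun y => Torus.partialDeriv m v y j) :=
    fun m j => (hD m).apply j
  set F : UnitAddTorus d → ℝ := fun x =>
    ∑ i, ∑ j, ((Torus.partialDeriv j v x i + Torus.partialDeriv i v x j) / 2) ^ 2 with hF_def
  have hFs : Torus.IsSmooth F := by
    have h : ∀ i j, Torus.IsSmooth (fun x =>
        ((Torus.partialDeriv j v x i + Torus.partialDeriv i v x j) / 2) ^ 2) :=
      fun i j => (((hDc j i).add (hDc i j)).div_const 2).pow 2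
    unfold Torus.IsSmooth at h ⊢
    exact ContDiff.sum fun i _ => ContDiff.sum fun j _ => h i j
  have hF32 : Integrable (fun x => F x * Real.sqrt (F x)) volume :=
    (hFs.continuous.mul hFs.continuous.sqrt).integrable_unitAddTorus
  have hpt : ∀ x, F x * Real.sqrt (F x) ≤ N * F x := by
    intro x
    have hF0 : 0 ≤ F x := Finset.sum_nonneg fun i _ => Finset.sum_nonneg fun j _ => sq_nonneg _
    have hsq : Real.sqrt (F x) ≤ N := by
      rw [← Real.sqrt_sq hN]
      exact Real.sqrt_le_sqrt (hS x)
    nlinarith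
  have hmono : ∫ x, F x * Real.sqrt (F x) ≤ ∫ x, N * F x :=
    integral_mono hF32 (hFs.integrable.const_mul N) hpt
  rw [integral_const_mul, integral_strainNormSq_eq_torusEnstrophy hv hdiv] at hmono
  -- production = −∫C ≤ (2√6/9)∫F√F
  have hcomm : enstrophyProduction v = ∫ x, ⟪Torus.laplacian v x, Torus.convect v v x⟫_ℝ := by
    unfold enstrophyProduction
    exact congrArg (fun f : UnitAddTorus d → ℝ => ∫ x, f x)
      (funext fun x => real_inner_comm (Torus.laplacian v x) (Torus.convect v v x))
  rw [hcomm, Torus.integral_inner_laplacian_convect_self_eq_neg hv hdiv]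
  refine (neg_integral_stretching_le_strain_cube hd hv hdiv).trans ?_
  have h6 : 0 ≤ 2 / 9 * Real.sqrt 6 := by positivity
  calc 2 / 9 * Real.sqrt 6 * ∫ x, F x * Real.sqrt (F x)
      ≤ 2 / 9 * Real.sqrt 6 * (N * torusEnstrophy v) := mul_le_mul_of_nonneg_left hmono h6
    _ = 2 / 9 * Real.sqrt 6 * N * torusEnstrophy v := by ring

/-- **Pressureless-type class: `σ ≤ (2√3/9)·M·ℰ`.** If `|S(x)|_F² ≤ ½M²` pointwise (`M ≥ 0`) —
in particular for PRESSURELESS smooth divergence-free fields (`∇p` constant ⟺ `|S|² = ½|ω|²`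
pointwise) with `|ω|² ≤ M²` — then `∫⟪(v·∇)v, Δv⟫ ≤ (2√3/9)·M·ℰ(v)` (`Σ = M/√2` above;
`(2√6/9)/√2 = 2√3/9 ≈ 0.385`). The bank's composition family shows `2√3/9` is the exact constant of
the pressureless class (`K1Q1-PRESSURELESS.md` §2, §4a; not formalised here). Search for candidate
a priori estimates; no regularity claim. [ours] -/
theorem enstrophyProduction_le_of_strainSq_le_half_sq (hd : Fintype.card d = 3)
    {v : UnitAddTorus d → EuclideanSpace ℝ d} (hv : Torus.IsSmooth v) (hdiv : Torus.IsDivFree v)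
    {M : ℝ} (hM : 0 ≤ M)
    (hS : ∀ x, (∑ i, ∑ j, ((Torus.partialDeriv j v x i + Torus.partialDeriv i v x j) / 2) ^ 2) ≤
      2⁻¹ * M ^ 2) :
    enstrophyProduction v ≤ 2 * Real.sqrt 3 / 9 * M * torusEnstrophy v := by
  have h2 : 0 < Real.sqrt 2 := Real.sqrt_pos.2 (by norm_num)
  have hN : 0 ≤ M / Real.sqrt 2 := div_nonneg hM h2.le
  have hS' : ∀ x, (∑ i, ∑ j, ((Torus.partialDeriv j v x i + Torus.partialDeriv i v x j) / 2) ^ 2) ≤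
      (M / Real.sqrt 2) ^ 2 := by
    intro x
    rw [div_pow, Real.sq_sqrt (by norm_num : (0:ℝ) ≤ 2)]
    linarith [hS x]
  have h := enstrophyProduction_le_strainSup hd hv hdiv hN hS'
  have h6 : Real.sqrt 6 = Real.sqrt 3 * Real.sqrt 2 := by
    rw [← Real.sqrt_mul (by norm_num : (0:ℝ) ≤ 3)]; norm_num
  have hconst : 2 / 9 * Real.sqrt 6 * (M / Real.sqrt 2) = 2 * Real.sqrt 3 / 9 * M := by
    rw [h6]
    field_simp
  rwa [hconst] at h

/-- The same with the pressureless IDENTITY `|S|² = ½|ω|²` as hypothesis. [ours; elementary] -/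
theorem enstrophyProduction_le_of_strainSq_eq_half_vorticitySq (hd : Fintype.card d = 3)
    {v : UnitAddTorus d → EuclideanSpace ℝ d} (hv : Torus.IsSmooth v) (hdiv : Torus.IsDivFree v)
    (hpl : ∀ x, (∑ i, ∑ j, ((Torus.partialDeriv j v x i + Torus.partialDeriv i v x j) / 2) ^ 2) =
      2⁻¹ * torusVorticitySqAt v x)
    {M : ℝ} (hM : 0 ≤ M) (hω : ∀ x, torusVorticitySqAt v x ≤ M ^ 2) :
    enstrophyProduction v ≤ 2 * Real.sqrt 3 / 9 * M * torusEnstrophy v :=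
  enstrophyProduction_le_of_strainSq_le_half_sq hd hv hdiv hM fun x =>
    (hpl x).le.trans (mul_le_mul_of_nonneg_left (hω x) (by norm_num))

end Summit.NavierStokesRegularity.FunctionalMining

end
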